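import Literature.AlgebraicGeometry.HodgeTheory.PolarizedLimitMixedHodgeStructureRescaledLimit
import Literature.AlgebraicGeometry.HodgeTheory.PolarizedLimitMixedHodgeStructureNilpotentOrbitRealClassesOfLowWeight
import Mathlib.Topology.MetricSpace.HausdorffDistance
import Mathlib.Topology.Order.Compact
import HarnessLib

/-!
# Quantitative transversality `W_m ∩ F̂_♯^q ∩ conj F̂_♯^q = 0` and CDK Prop. 4.8 at `d = 1`:
# along the nilpotent orbit, `‖N x‖_{θ(z)} ≤ (C / Im z) · dist_{θ(z)}(x, F^pθ(z))` for real `x` with `N x ∈ W_{k−3}`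

Topic `Literature/AlgebraicGeometry/HodgeTheory` (namespace `…HodgeTheory.PolarizedLimitMixedHodgeStructure`).  Theorems only; no
definition, no instance, no named fact (D-0026 net debt `0`).  The quantitative step of Cattani–Deligne–Kaplan's proof of
Thm. 2.16 at `d = 1` which the EXACT case (`…NilpotentOrbitRealClassesOfLowWeight`, CDK 4.8 as a pure weight argument:
«real `N u ∈ W_{k−3} ∩ F^{p−1}θ(z)` ⟹ `N u = 0`») replaces: when `u` is only CLOSE to `F^pθ(z)`, `N u` is only SMALL, at a rate.

PRINTED SOURCE, VERBATIM. E. Cattani, P. Deligne, A. Kaplan, *On the locus of Hodge classes*, J. Amer. Math. Soc. 8 (1995) 483–506.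
**Proposition 4.8** (p. 505). «`T₁u(n)` is exponentially small: of Hodge norm `< exp(−ρ sup(y_i(n)))` for suitable `ρ > 0`.
Proof. By 4.7, `T₁u(n)` is in `W¹₋₃`. It is also the sum of `X` in `Φ⁻¹(z(n))` and of an exponentially small `ε`. The same holds
after applying `e(τ(n))`. We gain that the `e(τ(n))Φ(z(n))` belong to a compact family of filtrations `F̃`, for which
`W¹₋₃ ∩ F̃⁻¹ ∩ conj F̃⁻¹ = 0`, so that `e(τ(n))T₁u(n)` must be exponentially small. Hence so is `T₁u(n)`.»  With **3.1** (p. 493):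
«on the space of pairs of subspaces `A, B` with `A ∩ B` of fixed dimension, the map `(A, B) ↦ A ∩ B` is continuous» and (3.6.2)
«`e(τ)Φ(z) → F_♯`».  (One variable: `d = 1`, `T₁ = N`, weight `0` ↦ weight `k = p + p`, `Φ⁻¹ ↦ F^{p−1}θ(z)`, `W¹₋₃ ↦ W_{k−3}`,
`e(τ) ↦ ĝ_z⁻¹`, `F̃ = u_{√Im z}·F̂_♯ → F̂_♯`.)

THE TREE'S SETTING. `L = (W, F, N, Q)` a polarized limit mixed Hodge structure of weight `k` on the finite-dimensional `ℚ`-space `V`,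
`θ(z) = exp(zN)·F` its nilpotent orbit (`Im z > β = L.normThreshold`), `(W, F̂)` the `δ`-splitting, `F̂_♯ = exp(iN)·F̂` (a pure Hodge
structure polarized by `Q`, the tree's `sharp`/`sharpPolarization`), `|·|₀ = ‖·‖_{F̂_♯}` the reference norm, `ĝ_z = exp((Re z)N) ρ̃(√Im z)`
(`orbitAut`; `θ(z)^p = ĝ_z·(u_{√Im z}·F̂_♯^p)`, `‖ĝ_z w‖_{θ̂(z)} = |w|₀`, `|u_t w − w|₀ ≤ (K/t²)|w|₀`), `½‖·‖_{θ̂(z)} ≤ ‖·‖_{θ(z)} ≤ (3/2)‖·‖_{θ̂(z)}`,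
`‖N w‖_{θ(z)} ≤ (C_N / Im z)‖w‖_{θ(z)}`.

WHAT IS FORMALIZED.
* §1 **QUANTITATIVE TRANSVERSALITY** (`exists_pos_forall_referenceNorm_le_sub_sharp_F`): for the mixed Hodge structure `(W, F̂_♯)` and
  `m < q + q` there is `c > 0` with **`c|v|₀ ≤ |v − f|₀` for every REAL `v ∈ W_{m,ℂ}` and every `f ∈ F̂_♯^q`** — the qualitative
  `W_m ∩ F̂_♯^q ∩ conj F̂_♯^q = 0` («`W¹₋₃ ∩ F̃⁻¹ ∩ conj F̃⁻¹ = 0`»; the tree's `eq_zero_of_conj_eq_of_mem_baseChange_W_of_mem_map_exp_F`) made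
  quantitative by compactness of the unit sphere of the real points of `W_{m,ℂ}` in `(V_ℂ, |·|₀)` and continuity of `v ↦ dist₀(v, F̂_♯^q)`.
* §2 **STABILITY IN A COMPACT FAMILY** (`referenceNorm_le_sub_of_forall_referenceNorm_sub_le`): if `|u w − w|₀ ≤ η|w|₀` for all `w` with
  `η ≤ 1/2`, `η ≤ c/4`, then `(c/4)|v|₀ ≤ |v − u f|₀` for the same `v`, `f` — the estimate persists for the filtrations `u·F̂_♯^q` near `F̂_♯^q`
  («belong to a compact family of filtrations `F̃`»), in particular for `u = u_{√Im z}`, `Im z ≥ max(2K, 4K/c)`.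
* §3 **CDK PROP. 4.8 AT `d = 1`, QUANTITATIVE** (`exists_forall_hodgeNorm_N_le_div_mul_hodgeNorm_sub`): for `k = p + p` there are
  `C ≥ 0` and `A` such that for every `z` with `Im z ≥ A`, every REAL `x ∈ V_ℂ` with **`N x ∈ W_{k−3,ℂ}`** (by CDK 4.7: `x ∈ W_{k,ℂ}` with
  `N(π̂_k x) = 0`, the tree's `N_apply_mem_baseChange_W_sub_three_of_N_deligneEProj_eq_zero`) and every `f ∈ F^pθ(z)`:
  **`‖N x‖_{θ(z)} ≤ (C / Im z) · ‖x − f‖_{θ(z)}`** — transport by `ĝ_z⁻¹` (real, `W`-preserving, isometric onto `|·|₀`): `ĝ_z⁻¹(N x)` is real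
  in `W_{k−3}`, `ĝ_z⁻¹(N f) ∈ u_{√Im z}·F̂_♯^{p−1}` (`N F^pθ(z) ⊆ F^{p−1}θ(z)`), and `|ĝ_z⁻¹N x − ĝ_z⁻¹N f|₀ ≤ 2‖N(x − f)‖_{θ(z)} ≤ 2(C_N/Im z)‖x − f‖_{θ(z)}`.
  Variants: with `x ∈ W_{k,ℂ}`, `N(π̂_k x) = 0`; the exact case `‖x − f‖ = 0 ⟹ N x = 0` recovered.

NOT HERE: the exponential smallness in a FIXED norm and the transfer to a bounded point (CDK 4.9) — the next file; several variables.

## References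

* [CattaniDeligneKaplan1995] E. Cattani, P. Deligne, A. Kaplan, *On the locus of Hodge classes*, J. Amer. Math. Soc. 8 (1995)
  483–506: 3.1 (pp. 493–494), Prop. 3.2 (p. 494), (3.6.2) (p. 497), Prop. 4.7, Prop. 4.8 and proof (pp. 503–505).
* [CattaniKaplanSchmid1987] E. Cattani, A. Kaplan, W. Schmid, LNM 1246 (1987): §3 Thm. (3.3) (i)–(ii), Cor. (3.6), Cor. (3.7).
* [DeligneHodgeII1971] P. Deligne, *Théorie de Hodge II*, Publ. Math. IHÉS 40 (1971): Thm. 2.3.5 (opposedness on `Gr^W`).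
* [Schmid1973] W. Schmid, Invent. Math. 22 (1973): Thm. (6.6) (cite only).
-/

noncomputable section

open scoped TensorProduct ComplexOrder
open Filter Topology

namespace Literature.AlgebraicGeometry

open Module
open Motives Motives.MixedHodgeStructure
open Motives.HodgeStructure (conj conj_conj conj_smul complexConj mem_complexConj conj_apply_eq_endConj endConj)

universe u

variable {V : Type u} [AddCommGroup V] [Module ℚ V] [FiniteDimensional ℚ V] {k : ℤ}

namespace HodgeTheory

namespace PolarizedLimitMixedHodgeStructure

variable (L : PolarizedLimitMixedHodgeStructure V k)

/-! ## §1 Quantitative transversality for the mixed Hodge structure `(W, F̂_♯)` in the reference norm -/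

/-- **A real vector of `W_{m,ℂ} ∩ F̂_♯^q` with `m < q + q` vanishes** — `(W, F̂_♯) = (W, exp(iN)·F̂)` is the mixed Hodge structure
`L̂.expTwist i` of the `δ`-splitting `L̂`. («`W¹₋₃ ∩ F̃⁻¹ ∩ conj F̃⁻¹ = 0`», for `F̃ = F_♯`.)
[cite: CattaniDeligneKaplan1995, proof of Prop. 4.8 (p. 505)] [cite: DeligneHodgeII1971, Thm. 2.3.5] -/
theorem eq_zero_of_conj_eq_of_mem_baseChange_W_of_mem_deltaSplit_sharp_F {m q : ℤ} (hmq : m < q + q) {v : ℂ ⊗[ℚ] V}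
    (hreal : conj v = v) (hW : v ∈ (L.W m).baseChange ℂ)
    (hF : v ∈ (L.deltaSplit.toLimitMixedHodgeStructure.sharp L.isSplitOverR_deltaSplit).F q) : v = 0 :=
  L.deltaSplit.eq_zero_of_conj_eq_of_mem_baseChange_W_of_mem_map_exp_F Complex.I hmq hreal hW hF

/-- **QUANTITATIVE TRANSVERSALITY.**  For `m < q + q` there is `c > 0` such that **`c|v|₀ ≤ |v − f|₀` for every real `v ∈ W_{m,ℂ}`
and every `f ∈ F̂_♯^q`**: the distance, in the reference norm `|·|₀ = ‖·‖_{F̂_♯}`, from a real vector of weight `≤ m` to the subspace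
`F̂_♯^q` is bounded below by a fixed multiple of its norm.  Proof: on the compact set of real `v ∈ W_{m,ℂ}` with `|v|₀ = 1` the
continuous function `v ↦ dist₀(v, F̂_♯^q)` attains a minimum `c`, positive because `dist₀(v, F̂_♯^q) = 0` forces `v ∈ F̂_♯^q` (closed),
hence `v = 0` (§1); homogeneity under real scalars gives the general case. [cite: CattaniDeligneKaplan1995, 3.1 and proof of Prop. 4.8 (pp. 493, 505)]
[cite: DeligneHodgeII1971, Thm. 2.3.5] -/
theorem exists_pos_forall_referenceNorm_le_sub_sharp_F {m q : ℤ} (hmq : m < q + q) :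
    ∃ c : ℝ, 0 < c ∧ ∀ v ∈ (L.W m).baseChange ℂ, conj v = v →
      ∀ f ∈ (L.deltaSplit.toLimitMixedHodgeStructure.sharp L.isSplitOverR_deltaSplit).F q,
        c * L.referenceNorm v ≤ L.referenceNorm (v - f) := by
  classical
  set P := L.deltaSplit.sharpPolarization L.isSplitOverR_deltaSplit with hP_def
  set Fq : Submodule ℂ (ℂ ⊗[ℚ] V) := (L.deltaSplit.toLimitMixedHodgeStructure.sharp L.isSplitOverR_deltaSplit).F q with hFq_def
  letI := P.hodgeNormedAddCommGroup
  letI := P.hodgeInnerProductSpace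
  have hnorm : ∀ v : ℂ ⊗[ℚ] V, ‖v‖ = L.referenceNorm v := fun v => rfl
  -- `conj` is an isometry of `|·|₀`, hence continuous
  have hconj_cont : Continuous (conj : ℂ ⊗[ℚ] V → ℂ ⊗[ℚ] V) := by
    have hiso : Isometry (conj : ℂ ⊗[ℚ] V → ℂ ⊗[ℚ] V) :=
      (AddMonoidHomClass.isometry_iff_norm (conj : ℂ ⊗[ℚ] V →ₗ[ℚ] ℂ ⊗[ℚ] V)).2 fun v => P.hodgeNorm_conj v
    exact hiso.continuous
  -- the compact set `K` of real unit vectors of `W_{m,ℂ}`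
  set K : Set (ℂ ⊗[ℚ] V) := ((L.W m).baseChange ℂ : Set (ℂ ⊗[ℚ] V)) ∩ ({v | conj v = v} ∩ Metric.sphere (0 : ℂ ⊗[ℚ] V) 1)
    with hK_def
  have hKclosed : IsClosed K :=
    (Submodule.closed_of_finiteDimensional _).inter ((isClosed_eq hconj_cont continuous_id).inter Metric.isClosed_sphere)
  have hKcpt : IsCompact K := (isCompact_sphere (0 : ℂ ⊗[ℚ] V) 1).of_isClosed_subset hKclosed fun v hv => hv.2.2
  -- the distance to `F̂_♯^q`
  have hFclosed : IsClosed (Fq : Set (ℂ ⊗[ℚ] V)) := Submodule.closed_of_finiteDimensional _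
  have hFne : (Fq : Set (ℂ ⊗[ℚ] V)).Nonempty := ⟨0, Fq.zero_mem⟩
  have hcont : Continuous fun v : ℂ ⊗[ℚ] V => Metric.infDist v (Fq : Set (ℂ ⊗[ℚ] V)) := Metric.continuous_infDist_pt _
  -- positivity of the distance on `K`
  have hpos : ∀ v ∈ K, 0 < Metric.infDist v (Fq : Set (ℂ ⊗[ℚ] V)) := by
    rintro v ⟨hvW, hvr, hvs⟩
    refine lt_of_le_of_ne Metric.infDist_nonneg fun h0 => ?_
    have hvF : v ∈ (Fq : Set (ℂ ⊗[ℚ] V)) := by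
      rw [← hFclosed.closure_eq, Metric.mem_closure_iff_infDist_zero hFne]
      exact h0.symm
    have hv0 : v = 0 := L.eq_zero_of_conj_eq_of_mem_baseChange_W_of_mem_deltaSplit_sharp_F hmq hvr hvW hvF
    rw [mem_sphere_zero_iff_norm, hv0, norm_zero] at hvs
    exact zero_ne_one hvs
  -- the constant
  rcases K.eq_empty_or_nonempty with hKe | hKne
  · -- no real unit vector in `W_{m,ℂ}`: every real `v ∈ W_{m,ℂ}` is `0`
    refine ⟨1, one_pos, fun v hvW hvr f _ => ?_⟩
    by_cases hv0 : v = 0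
    · rw [hv0, (L.referenceNorm_eq_zero_iff _).2 rfl, mul_zero]
      exact L.referenceNorm_nonneg _
    · exfalso
      have ht : 0 < ‖v‖ := norm_pos_iff.2 hv0
      set v₁ : ℂ ⊗[ℚ] V := (((‖v‖)⁻¹ : ℝ) : ℂ) • v with hv₁_def
      have hv₁K : v₁ ∈ K := by
        refine ⟨Submodule.smul_mem _ _ hvW, ?_, ?_⟩
        · show conj v₁ = v₁
          rw [hv₁_def, conj_smul, Complex.conj_ofReal, hvr]
        · rw [mem_sphere_zero_iff_norm, hv₁_def, norm_smul, Complex.norm_real, Real.norm_eq_abs, abs_of_pos (inv_pos.2 ht),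
            inv_mul_cancel₀ ht.ne']
      rw [hKe] at hv₁K
      exact hv₁K
  · obtain ⟨v₀, hv₀K, hmin⟩ := hKcpt.exists_isMinOn hKne hcont.continuousOn
    refine ⟨Metric.infDist v₀ (Fq : Set (ℂ ⊗[ℚ] V)), hpos v₀ hv₀K, fun v hvW hvr f hf => ?_⟩
    by_cases hv0 : v = 0
    · rw [hv0, (L.referenceNorm_eq_zero_iff _).2 rfl, mul_zero]
      exact L.referenceNorm_nonneg _
    · have ht : 0 < ‖v‖ := norm_pos_iff.2 hv0
      set v₁ : ℂ ⊗[ℚ] V := (((‖v‖)⁻¹ : ℝ) : ℂ) • v with hv₁_def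
      have hv₁K : v₁ ∈ K := by
        refine ⟨Submodule.smul_mem _ _ hvW, ?_, ?_⟩
        · show conj v₁ = v₁
          rw [hv₁_def, conj_smul, Complex.conj_ofReal, hvr]
        · rw [mem_sphere_zero_iff_norm, hv₁_def, norm_smul, Complex.norm_real, Real.norm_eq_abs, abs_of_pos (inv_pos.2 ht),
            inv_mul_cancel₀ ht.ne']
      have hle : Metric.infDist v₀ (Fq : Set (ℂ ⊗[ℚ] V)) ≤ Metric.infDist v₁ (Fq : Set (ℂ ⊗[ℚ] V)) := hmin hv₁K
      -- `dist₀(v₁, F̂_♯^q) ≤ |v₁ − ‖v‖⁻¹ f|₀ = ‖v‖⁻¹ |v − f|₀`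
      have hf₁ : (((‖v‖)⁻¹ : ℝ) : ℂ) • f ∈ (Fq : Set (ℂ ⊗[ℚ] V)) := Fq.smul_mem _ hf
      have hd : Metric.infDist v₁ (Fq : Set (ℂ ⊗[ℚ] V)) ≤ (‖v‖)⁻¹ * ‖v - f‖ := by
        refine (Metric.infDist_le_dist_of_mem hf₁).trans (le_of_eq ?_)
        rw [dist_eq_norm, hv₁_def, ← smul_sub, norm_smul, Complex.norm_real, Real.norm_eq_abs, abs_of_pos (inv_pos.2 ht)]
      rw [← hnorm, ← hnorm]
      have h := hle.trans hd
      calc Metric.infDist v₀ (Fq : Set (ℂ ⊗[ℚ] V)) * ‖v‖ ≤ (‖v‖)⁻¹ * ‖v - f‖ * ‖v‖ := mul_le_mul_of_nonneg_right h ht.le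
        _ = ‖v - f‖ := by field_simp

/-! ## §2 Stability of the lower bound in a compact family of filtrations `u·F̂_♯^q`, `u → 1` -/

/-- **The transversality bound persists under a small perturbation of the filtration**: if `c|v|₀ ≤ |v − f|₀` for all `f ∈ S`
and `|u w − w|₀ ≤ η|w|₀` for all `w`, with `η ≤ 1/2` and `η ≤ c/4`, then **`(c/4)|v|₀ ≤ |v − u f|₀` for all `f ∈ S`** — «the
`e(τ(n))Φ(z(n))` belong to a compact family of filtrations `F̃`, for which `W¹₋₃ ∩ F̃⁻¹ ∩ conj F̃⁻¹ = 0`» (here the family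
`u_{√Im z}·F̂_♯`, `u_t → 1`). [cite: CattaniDeligneKaplan1995, Prop. 3.2 and proof of Prop. 4.8 (pp. 494, 505)] [cite: CattaniKaplanSchmid1987, §3 Cor. (3.6)] -/
theorem referenceNorm_le_sub_of_forall_referenceNorm_sub_le {c η : ℝ} (hη0 : 0 ≤ η) (hη2 : η ≤ 1 / 2) (hηc : η ≤ c / 4)
    {u : Module.End ℂ (ℂ ⊗[ℚ] V)} (hu : ∀ w, L.referenceNorm (u w - w) ≤ η * L.referenceNorm w) {S : Set (ℂ ⊗[ℚ] V)}
    {v : ℂ ⊗[ℚ] V} (hv : ∀ f ∈ S, c * L.referenceNorm v ≤ L.referenceNorm (v - f)) {f : ℂ ⊗[ℚ] V} (hf : f ∈ S) :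
    c / 4 * L.referenceNorm v ≤ L.referenceNorm (v - u f) := by
  set P := L.deltaSplit.sharpPolarization L.isSplitOverR_deltaSplit with hP_def
  have hd := hv f hf
  have huf := hu f
  have h0v := L.referenceNorm_nonneg v
  have h0d := L.referenceNorm_nonneg (v - f)
  have h0d' := L.referenceNorm_nonneg (v - u f)
  have h0f := L.referenceNorm_nonneg f
  -- `|f|₀ ≤ |v|₀ + |v - f|₀`
  have hfle : L.referenceNorm f ≤ L.referenceNorm v + L.referenceNorm (v - f) := by
    have h := P.hodgeNorm_le_add_hodgeNorm_sub f v
    rw [P.hodgeNorm_sub_rev f v] at h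
    exact h
  -- `|v - f|₀ ≤ |v - u f|₀ + |u f - f|₀`
  have hdle : L.referenceNorm (v - f) ≤ L.referenceNorm (v - u f) + L.referenceNorm (u f - f) := by
    have e : v - f = (v - u f) + (u f - f) := by abel
    have h := P.hodgeNorm_add_le (v - u f) (u f - f)
    rw [← e] at h
    exact h
  have h1 : L.referenceNorm (v - f) ≤ L.referenceNorm (v - u f) + η * (L.referenceNorm v + L.referenceNorm (v - f)) :=
    hdle.trans (by nlinarith)
  have hηd : η * L.referenceNorm (v - f) ≤ 1 / 2 * L.referenceNorm (v - f) := mul_le_mul_of_nonneg_right hη2 h0d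
  have h2 : L.referenceNorm (v - f) ≤ 2 * L.referenceNorm (v - u f) + 2 * (η * L.referenceNorm v) := by nlinarith
  have h3 : η * L.referenceNorm v ≤ c / 4 * L.referenceNorm v := mul_le_mul_of_nonneg_right hηc h0v
  nlinarith

/-! ## §3 CDK Prop. 4.8 at `d = 1`: `‖N x‖_{θ(z)} ≤ (C / Im z) · dist_{θ(z)}(x, F^pθ(z))` -/

/-- `N` lowers the Hodge filtration of the orbit: `x ∈ F^aθ(z) ⟹ N x ∈ F^{a−1}θ(z)` (`θ(z) = exp(zN)·F` is the Hodge filtration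
of the limit mixed Hodge structure `L.expTwist z`). [cite: CattaniDeligneKaplan1995, 2.7 ("the N_j … lie in 𝔤^{−1,−1}") and proof of Prop. 4.8 (p. 505)] -/
theorem N_apply_mem_nilpotentOrbit_F {z : ℂ} (hz : L.orbitThreshold < z.im) {a : ℤ} {x : ℂ ⊗[ℚ] V}
    (hx : x ∈ (L.nilpotentOrbit z hz).F a) : L.N.baseChange ℂ x ∈ (L.nilpotentOrbit z hz).F (a - 1) := by
  rw [L.nilpotentOrbit_F] at hx ⊢
  have h := (L.expTwist z).map_N_F_le a
  rw [L.expTwist_F, L.expTwist_F, L.expTwist_N] at h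
  exact h ⟨x, hx, rfl⟩

/-- `N x` is real when `x` is (`N` is defined over `ℚ`). [folklore] -/
private theorem conj_N_baseChange_of_conj_eq {x : ℂ ⊗[ℚ] V} (hreal : conj x = x) : conj (L.N.baseChange ℂ x) = L.N.baseChange ℂ x := by
  rw [HodgeStructure.conj_baseChange, hreal]

/-- **CDK PROP. 4.8 AT `d = 1`, QUANTITATIVE.**  Let `k = p + p`.  There are `C ≥ 0` and `A` such that for every `z` with `Im z > β`,
`Im z ≥ A`, every REAL `x ∈ V_ℂ` with **`N x ∈ W_{k−3,ℂ}`** and every `f ∈ F^pθ(z)`: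
**`‖N x‖_{θ(z)} ≤ (C / Im z) · ‖x − f‖_{θ(z)}`.**  («By 4.7, `T₁u(n)` is in `W¹₋₃`. It is also the sum of `X` in `Φ⁻¹(z(n))` and of
an exponentially small `ε`. The same holds after applying `e(τ(n))` … so that `e(τ(n))T₁u(n)` must be exponentially small. Hence so
is `T₁u(n)`.»)  Proof: `v = ĝ_z⁻¹(N x)` is real in `W_{k−3,ℂ}`, `ĝ_z⁻¹(N f) = u_{√Im z} f'` with `f' ∈ F̂_♯^{p−1}` (`N f ∈ F^{p−1}θ(z)`,
`θ(z)^{p−1} = ĝ_z·(u_{√Im z}·F̂_♯^{p−1})`); by §1–§2, `(c/4)|v|₀ ≤ |v − ĝ_z⁻¹(N f)|₀ ≤ 2‖N(x − f)‖_{θ(z)} ≤ 2(C_N/Im z)‖x − f‖_{θ(z)}`, and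
`‖N x‖_{θ(z)} ≤ (3/2)‖N x‖_{θ̂(z)} = (3/2)|v|₀`. [cite: CattaniDeligneKaplan1995, Prop. 4.8 and proof (p. 505), (3.6.1)–(3.6.2) (p. 497)]
[cite: CattaniKaplanSchmid1987, §3 Thm. (3.3), Cor. (3.7)] [cite: Schmid1973, Thm. (6.6) (cite only)] -/
theorem exists_forall_hodgeNorm_N_le_div_mul_hodgeNorm_sub {p : ℤ} (hpk : p + p = k) :
    ∃ C : ℝ, 0 ≤ C ∧ ∃ A : ℝ, ∀ (z : ℂ) (hz : L.normThreshold < z.im), A ≤ z.im → ∀ x : ℂ ⊗[ℚ] V, conj x = x →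
      L.N.baseChange ℂ x ∈ (L.W (k - 3)).baseChange ℂ → ∀ f ∈ (L.nilpotentOrbit z (L.orbitThreshold_lt_im hz)).F p,
        (L.nilpotentOrbitPolarization z (L.orbitThreshold_lt_im hz)).hodgeNorm (L.N.baseChange ℂ x) ≤
          C / z.im * (L.nilpotentOrbitPolarization z (L.orbitThreshold_lt_im hz)).hodgeNorm (x - f) := by
  classical
  have hs' := L.isSplitOverR_deltaSplit
  obtain ⟨c, hc, hcv⟩ := L.exists_pos_forall_referenceNorm_le_sub_sharp_F (m := k - 3) (q := p - 1) (by omega)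
  obtain ⟨K, hK0, hK⟩ := L.exists_hodgeNorm_orbitPerturbation_sub_le
  obtain ⟨CN, hCN0, hCN⟩ := L.exists_hodgeNorm_N_nilpotentOrbit_le
  refine ⟨12 * CN / c, by positivity, max (2 * K) (4 * K / c), fun z hz hAz x hreal hNW f hf => ?_⟩
  have hz0 : 0 < z.im := L.im_pos_of_normThreshold_lt hz
  have hy1 : 1 ≤ z.im := L.one_le_im_of_normThreshold_lt hz
  have ht1 : 1 ≤ Real.sqrt z.im := by rw [← Real.sqrt_one]; exact Real.sqrt_le_sqrt hy1
  have ht2 : Real.sqrt z.im ^ 2 = z.im := Real.sq_sqrt hz0.le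
  set Pz := L.nilpotentOrbitPolarization z (L.orbitThreshold_lt_im hz) with hPz_def
  -- the rescaled vectors `v = ĝ_z⁻¹ (N x)` and `g = ĝ_z⁻¹ (N f)`
  obtain ⟨v, hv⟩ := L.deltaSplit.toLimitMixedHodgeStructure.orbitAut_surjective hz0 (L.N.baseChange ℂ x)
  obtain ⟨g, hg⟩ := L.deltaSplit.toLimitMixedHodgeStructure.orbitAut_surjective hz0 (L.N.baseChange ℂ f)
  have hvreal : conj v = v := L.conj_eq_of_orbitAut_eq hz0 hv (L.conj_N_baseChange_of_conj_eq hreal)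
  have hvW : v ∈ (L.W (k - 3)).baseChange ℂ := L.mem_baseChange_W_of_orbitAut_eq hz0 hv hNW
  have hNf : L.N.baseChange ℂ f ∈ (L.nilpotentOrbit z (L.orbitThreshold_lt_im hz)).F (p - 1) := L.N_apply_mem_nilpotentOrbit_F _ hf
  have hgF : g ∈ ((L.deltaSplit.toLimitMixedHodgeStructure.sharp hs').F (p - 1)).map (L.orbitPerturbation (Real.sqrt z.im)) :=
    L.mem_map_orbitPerturbation_sharp_F_of_orbitAut_eq (L.orbitThreshold_lt_im hz) hz0 hg hNf
  obtain ⟨f', hf'F, hf'g⟩ := hgF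
  -- §2 applies with `η = K / Im z`
  have hη : ∀ w, L.referenceNorm (L.orbitPerturbation (Real.sqrt z.im) w - w) ≤ K / z.im * L.referenceNorm w := by
    intro w
    have h := hK _ ht1 w
    rwa [ht2] at h
  have hA1 : 2 * K ≤ z.im := (le_max_left _ _).trans hAz
  have hA2 : 4 * K / c ≤ z.im := (le_max_right _ _).trans hAz
  have hη2 : K / z.im ≤ 1 / 2 := by rw [div_le_iff₀ hz0]; linarith
  have hηc : K / z.im ≤ c / 4 := by
    rw [div_le_iff₀ hz0]
    rw [div_le_iff₀ hc] at hA2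
    linarith
  have hη0 : 0 ≤ K / z.im := div_nonneg hK0 hz0.le
  have hkey : c / 4 * L.referenceNorm v ≤ L.referenceNorm (v - g) := by
    have h := L.referenceNorm_le_sub_of_forall_referenceNorm_sub_le hη0 hη2 hηc hη
      (S := ((L.deltaSplit.toLimitMixedHodgeStructure.sharp hs').F (p - 1) : Set (ℂ ⊗[ℚ] V)))
      (fun f₁ hf₁ => hcv v hvW hvreal f₁ hf₁) hf'F
    rwa [hf'g] at h
  -- `|v − g|₀ ≤ 2 ‖N (x − f)‖_{θ(z)} ≤ 2 (C_N / Im z) ‖x − f‖_{θ(z)}`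
  have hvg : L.referenceNorm (v - g) ≤ 2 * (CN / z.im * Pz.hodgeNorm (x - f)) := by
    have h1 : L.referenceNorm (v - g) ≤ 2 * Pz.hodgeNorm (L.N.baseChange ℂ x - L.N.baseChange ℂ f) :=
      L.referenceNorm_le_two_mul_hodgeNorm_of_orbitAut_eq hz (by rw [map_sub, hv, hg])
    rw [← map_sub] at h1
    exact h1.trans (mul_le_mul_of_nonneg_left (hCN z hz (x - f)) (by norm_num))
  -- `‖N x‖_{θ(z)} ≤ (3/2) |v|₀`
  have hNx : Pz.hodgeNorm (L.N.baseChange ℂ x) ≤ 3 / 2 * L.referenceNorm v := by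
    have h := (L.hodgeNorm_nilpotentOrbit_mem_Icc hz (L.N.baseChange ℂ x)).2
    rwa [← hv, L.hodgeNorm_splitNilpotentOrbit_orbitAut hz0, hv] at h
  have hc4 : 0 < c / 4 := by positivity
  have hc0 : c ≠ 0 := hc.ne'
  have hy0 : z.im ≠ 0 := hz0.ne'
  calc Pz.hodgeNorm (L.N.baseChange ℂ x) ≤ 3 / 2 * L.referenceNorm v := hNx
    _ ≤ 3 / 2 * ((4 / c) * (2 * (CN / z.im * Pz.hodgeNorm (x - f)))) := by
        refine mul_le_mul_of_nonneg_left ?_ (by norm_num)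
        calc L.referenceNorm v ≤ L.referenceNorm (v - g) / (c / 4) := (le_div_iff₀' hc4).2 hkey
          _ = 4 / c * L.referenceNorm (v - g) := by rw [div_div_eq_mul_div]; ring
          _ ≤ 4 / c * (2 * (CN / z.im * Pz.hodgeNorm (x - f))) := mul_le_mul_of_nonneg_left hvg (by positivity)
    _ = 12 * CN / c / z.im * Pz.hodgeNorm (x - f) := by
        field_simp
        ring

/-- **The form with the hypothesis of CDK 4.7**: for real `x ∈ W_{k,ℂ}` whose top component is `N`-invariant, `N(π̂_k x) = 0` (so that
`N x ∈ W_{k−3,ℂ}`, the tree's `N_apply_mem_baseChange_W_sub_three_of_N_deligneEProj_eq_zero`), and `f ∈ F^pθ(z)`, `Im z ≥ A`: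
`‖N x‖_{θ(z)} ≤ (C / Im z)‖x − f‖_{θ(z)}`. [cite: CattaniDeligneKaplan1995, Prop. 4.7 and Prop. 4.8 (pp. 503–505)] -/
theorem exists_forall_hodgeNorm_N_le_div_mul_hodgeNorm_sub_of_N_deligneEProj_eq_zero {p : ℤ} (hpk : p + p = k) :
    ∃ C : ℝ, 0 ≤ C ∧ ∃ A : ℝ, ∀ (z : ℂ) (hz : L.normThreshold < z.im), A ≤ z.im → ∀ x : ℂ ⊗[ℚ] V, conj x = x →
      x ∈ (L.W k).baseChange ℂ → L.N.baseChange ℂ (L.deltaSplit.toMixedHodgeStructure.deligneEProj k x) = 0 →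
        ∀ f ∈ (L.nilpotentOrbit z (L.orbitThreshold_lt_im hz)).F p,
          (L.nilpotentOrbitPolarization z (L.orbitThreshold_lt_im hz)).hodgeNorm (L.N.baseChange ℂ x) ≤
            C / z.im * (L.nilpotentOrbitPolarization z (L.orbitThreshold_lt_im hz)).hodgeNorm (x - f) := by
  obtain ⟨C, hC0, A, h⟩ := L.exists_forall_hodgeNorm_N_le_div_mul_hodgeNorm_sub hpk
  exact ⟨C, hC0, A, fun z hz hAz x hreal hW hN f hf =>
    h z hz hAz x hreal (L.N_apply_mem_baseChange_W_sub_three_of_N_deligneEProj_eq_zero hW hN) f hf⟩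

/-- **The exact case recovered: a real `x` with `N x ∈ W_{k−3,ℂ}` which lies IN `F^pθ(z)` (`Im z ≥ A`) has `N x = 0`** (`‖x − x‖ = 0`);
cf. the tree's weight-argument proof `N_apply_eq_zero_of_conj_eq_of_mem_nilpotentOrbit_piece_of_N_apply_mem_baseChange_W`, valid at
every point of the orbit. [cite: CattaniDeligneKaplan1995, Prop. 4.8 (p. 505)] -/
theorem exists_forall_N_apply_eq_zero_of_mem_nilpotentOrbit_F {p : ℤ} (hpk : p + p = k) :
    ∃ A : ℝ, ∀ (z : ℂ) (hz : L.normThreshold < z.im), A ≤ z.im → ∀ x : ℂ ⊗[ℚ] V, conj x = x →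
      L.N.baseChange ℂ x ∈ (L.W (k - 3)).baseChange ℂ → x ∈ (L.nilpotentOrbit z (L.orbitThreshold_lt_im hz)).F p →
        L.N.baseChange ℂ x = 0 := by
  obtain ⟨C, -, A, h⟩ := L.exists_forall_hodgeNorm_N_le_div_mul_hodgeNorm_sub hpk
  refine ⟨A, fun z hz hAz x hreal hNW hx => ?_⟩
  have h1 := h z hz hAz x hreal hNW x hx
  rw [sub_self, HodgeStructure.Polarization.hodgeNorm_zero, mul_zero] at h1
  exact (HodgeStructure.Polarization.hodgeNorm_eq_zero_iff _ _).1 (le_antisymm h1 (HodgeStructure.Polarization.hodgeNorm_nonneg _ _))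

/-- **Sequence form («`T₁u(n)` is exponentially small»)**: for real `x_n` with `N x_n ∈ W_{k−3,ℂ}` and `f_n ∈ F^pθ(z_n)`,
`‖x_n − f_n‖_{θ(z_n)} ≤ ε_n`, `Im z_n → ∞`: eventually `‖N x_n‖_{θ(z_n)} ≤ (C / Im z_n) ε_n` — with `ε_n = e^{−α Im z_n}‖x_n‖` this is the
printed exponential smallness in the Hodge norm at `θ(z_n)`. [cite: CattaniDeligneKaplan1995, Prop. 4.8 (p. 505)] -/
theorem exists_eventually_hodgeNorm_N_le_of_seq {p : ℤ} (hpk : p + p = k) (x : ℕ → ℂ ⊗[ℚ] V) (z : ℕ → ℂ)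
    (hz : ∀ n, L.normThreshold < (z n).im) (hlim : Tendsto (fun n => (z n).im) atTop atTop) (hreal : ∀ n, conj (x n) = x n)
    (hNW : ∀ n, L.N.baseChange ℂ (x n) ∈ (L.W (k - 3)).baseChange ℂ) (f : ℕ → ℂ ⊗[ℚ] V)
    (hf : ∀ n, f n ∈ (L.nilpotentOrbit (z n) (L.orbitThreshold_lt_im (hz n))).F p) (ε : ℕ → ℝ)
    (hε : ∀ n, (L.nilpotentOrbitPolarization (z n) (L.orbitThreshold_lt_im (hz n))).hodgeNorm (x n - f n) ≤ ε n) :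
    ∃ C : ℝ, 0 ≤ C ∧ ∀ᶠ n in atTop,
      (L.nilpotentOrbitPolarization (z n) (L.orbitThreshold_lt_im (hz n))).hodgeNorm (L.N.baseChange ℂ (x n)) ≤ C / (z n).im * ε n := by
  obtain ⟨C, hC0, A, h⟩ := L.exists_forall_hodgeNorm_N_le_div_mul_hodgeNorm_sub hpk
  refine ⟨C, hC0, (hlim.eventually (eventually_ge_atTop A)).mono fun n hn => ?_⟩
  have hz0 : 0 < (z n).im := L.im_pos_of_normThreshold_lt (hz n)
  exact (h (z n) (hz n) hn (x n) (hreal n) (hNW n) (f n) (hf n)).trans (mul_le_mul_of_nonneg_left (hε n) (div_nonneg hC0 hz0.le))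

end PolarizedLimitMixedHodgeStructure

end HodgeTheory

end Literature.AlgebraicGeometry

end
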